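import Summits.BirchSwinnertonDyer.BirchSwinnertonDyer.Theorems.KolyvaginDepthDoorDepthTableKuriharaAnomalous
import HarnessLib
import Literature.NumberTheory.EllipticCurves.KuriharaNumberKimModPSelmerBound

/-!
# Route `KolyvaginDepthDoor`, crux `KolyvaginDepthSupplyKN` (stmt-BirchSwinnertonDyer-22820) —
# DEPTH TABLE v25, GENERIC: «KIM'S THEOREM 1.11 AS PRINTED AT ANY GOOD PRIME» — the E-side bit
# `Ш(E/ℚ)[p] = 0` from ONE unit mod-`p` Kurihara number at a good prime `p ≥ 5` of ANY reduction type
# (ordinary or SUPERSINGULAR), under the four printed hypotheses (i) `ρ̄` onto, (ii) Manin, (iii)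
# `E(ℚ_p)[p] = 0`, (iv) `p ∤ ∏ c_v` — and the two binders a supersingular row needs

Helper file of the lead prover of line `levelone` (kdd-p1 g29; `--supports stmt-BirchSwinnertonDyer-22820
--as helper`); it closes nothing and BSD is NOT proved by it.

WHY. Every E-side reading of the depth table (v17 `natCard_selmerGroup_le_pow_of_kuriharaClaim`, v22 decisive
pair, v23 tuple, v24 `…_of_localTorsionTrivial`) rests on the tree's transcription
`Kim2022_card_selmerGroup_le_pow_of_kuriharaNumber_ne_zero` of C.-H. Kim, Amer. J. Math. 148 (2026) Thm. 1.11
(journal Thm. 1.10), which carries the binder `IsOrdinaryAt W p` — but ONLY because that transcription routes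
its reading through statement (3) of the theorem (the cyclotomic Iwasawa main identity, a theorem at good ORDINARY
`p`). The PRINTED theorem has NO hypothesis on the reduction of `E` at `p` at all: "Let `E` be an elliptic
curve over `ℚ` and `p ≥ 5` a prime such that `ρ̄` is surjective, the Manin constant is prime to `p`,
`E(ℚ_p)[p] = 0`, and all the Tamagawa factors are prime to `p`. Then the following statements are equivalent.
(1) `δ̃^{(1)}_n ≠ 0` in `𝔽_p` for some `n ∈ 𝒩_1` with `ν(n) = ord(δ̃^{(1)})`. (2) […] (3) […]. In this case,
the canonical homomorphism `Sel(ℚ, E[p]) → ⊕_{ℓ∣n} (E(ℚ_ℓ) ⊗ ℤ/pℤ) ≃ ⊕_{ℓ∣n} (E(𝔽_ℓ) ⊗ ℤ/pℤ)` is an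
isomorphism" (arXiv v3 PDF p. 8; setting §1.2.1 "Let `E` be an elliptic curve over `ℚ` of conductor `N` and
`p ≥ 5` a prime"; the paper's Thm. 1.1 is stated for "a semi-stable reduction prime", its Cor. 3.5 for
"good reduction at `p ≥ 5`" with `p ∤ #Ẽ(k)`, and after Thm. 1.11: "The non-anomalous good reduction case is
studied in [kim-kato]"), and its proof (§6, PDF p. 31: "Thus, `Sel_n(ℚ, E[p]) = 0` […], so `loc_n` is
injective under `δ̃^{(1)}_n ≠ 0`", from Büyükboduk's Thm. 6.1 whose hypotheses are (i), (iii), (iv)) reads a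
unit at a cyclic level `n` DIRECTLY as `dim_{𝔽_p} Sel(ℚ, E[p]) ≤ ν(n)`, with no appeal to (3). So the
7 969 depth-two unit records of rank-two curves at SUPERSINGULAR `p` in the tree (13 % of 61 209; g28's
AGREEMENT-TEST-v24 «outside print as transcribed», all with invertible localisation matrices) are INSIDE
print: at a good supersingular `p ≥ 5` one has `a_p = 0`, so `p ∤ #Ẽ(𝔽_p) = p + 1` and (iii) holds by the
point count (§3.1.1 of the paper; tree `localTorsion_eq_zero_of_good_of_not_dvd_frobeniusTrace_sub_one`).

CONTENTS (theorems + ONE new named fact stated inline for relocation; no `_holds` — size XL).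
* §0 `Kim2022_card_selmerGroup_le_pow_of_kuriharaNumber_ne_zero_of_hasGoodReduction` — the named fact:
  Kim's Thm. 1.11 «in this case» bound `#Sel_p(E/ℚ) ≤ p^{ν(n)}` at ANY GOOD `p ≥ 5` (binders of the ordinary
  fact with `IsOrdinaryAt` replaced by `HasGoodReductionAtPrime`; weaker than print, which has no reduction
  hypothesis); `kim2022_card_selmerGroup_le_pow_of_hasGoodReduction_imp_ordinary` — bridge: it implies the
  tree's ordinary fact (so v17–v24 follow from it too).
* §1 `natCard_selmerGroup_le_pow_of_kuriharaClaim_of_hasGoodReduction` /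
  `sha_inf_torsionBy_eq_bot_of_kuriharaClaim_of_hasGoodReduction` — v24's E-side reading with `hord` GONE
  and (iv) in its EXACT printed form `¬ p ∣ W.tamagawaProduct`.
* §2 binders: `localTorsionTrivial_of_supersingular` ((iii) at a good `p ≥ 3` with `p ∣ a_p`);
  `not_dvd_tamagawaProduct_of_splitKodairaNeron` ((iv) from `p ∤ ord_v(Δ_min)` at the SPLIT multiplicative
  places only — the tree's `CornerLocal.not_dvd_tamagawaProduct_iff_forall`; the Kodaira–Néron clause of the
  crux, all multiplicative places, is the special case `not_dvd_tamagawaProduct_of_kodairaNeron`).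
* §3 row shapes for a literal integral model: `sha_inf_torsionBy_eq_bot_of_kuriharaClaim_of_supersingular`
  (the supersingular one-way row) and `sha_inf_torsionBy_eq_bot_of_kuriharaClaim_of_hasGoodReduction_int`
  (any good `p`, (iii) as a binder, split Kodaira–Néron).

HONEST FRAMING. A supersingular `p` is NOT an admissible prime of the crux (`KolyvaginDepthSupplyKN` and
KatoTransfer's X1 want `p` ordinary): these are INSTRUMENT rows of the depth table's E-side (agreement of the
fleet's records with print), not instances of the crux's clause. ONE WAY («unit ⟹ `Ш(E)[p] = 0`»): the
prescribed-level converse (Sakamoto 2022 L4.4/L4.6) is printed under «(a) good ordinary». CONDITIONAL on the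
named facts displayed as hypotheses (`hKimG`, `hnf`, `hMaz`) and on the Kurihara CLAIM; per `(W, p, n)`;
nothing class-wide (the open stub (S♭) is untouched); BSD is NOT proved by any of this.

References: [Kim2022StructureSelmer] C.-H. Kim, Amer. J. Math. 148 (2026) 79–129 = arXiv:2203.12159, Thm.
1.11 (journal 1.10) with its "In this case" clause (PDF p. 8), §1.2.1–1.2.2, §1.4.1–1.4.4, §3.1.1, Cor. 3.5,
Thm. 3.13, §6 (PDF p. 31), Thm. 6.1 (= K. Büyükboduk, IMRN 2011 no. 14, 3141–3206); [Kurihara2014] Thm.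
1.2.3 (1); [SilvermanAEC2009] VII.2.1, VII.3.1, X.4.2; [SilvermanATAEC1994]
Cor. IV.9.2 (d); [Mazur1978] Cor. 4.1.
-/

set_option linter.dupNamespace false

noncomputable section

open scoped Classical NumberField

/-! ## §0 The named print input: Kim 2026, Theorem 1.11 at ANY GOOD prime, BY NAME (stated inline; the
gate relocates it under `Literature/NumberTheory/EllipticCurves/KuriharaNumberKimModPSelmerBound`) -/

namespace Literature.NumberTheory.EllipticCurves

end Literature.NumberTheory.EllipticCurves

namespace Summit.BirchSwinnertonDyer.BirchSwinnertonDyer.Theorems.KolyvaginDepthDoor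

open Literature.NumberTheory.EllipticCurves Literature.NumberTheory.EllipticCurves.ModularForms
  WeierstrassCurve NumberField IsDedekindDomain
open Summit.BirchSwinnertonDyer.BirchSwinnertonDyer.Theorems

/-- **Bridge: the good-prime reading of Kim's Theorem 1.11 implies the tree's ordinary reading** (the latter's
binder `IsOrdinaryAt W p` is `W.HasGoodReductionAtPrime p ∧ p ∤ a_p`; drop the second conjunct). So every
E-side row of v17–v24 (hypothesis `hKim`) follows from `hKimG` as well. [cite: Kim2022StructureSelmer, Thm. 1.11 (PDF p. 8)] -/
theorem kim2022_card_selmerGroup_le_pow_of_hasGoodReduction_imp_ordinary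
    (hKimG : Literature.NumberTheory.EllipticCurves.Kim2022_card_selmerGroup_le_pow_of_kuriharaNumber_ne_zero_of_hasGoodReduction) :
    Kim2022_card_selmerGroup_le_pow_of_kuriharaNumber_ne_zero :=
  fun W _ _ p _ h5 hord hsur ht0 htam _ _ D hc hu n _ hn ψ hψ hne ↦
    hKimG W p h5 hord.1 hsur ht0 htam D hc hu n hn ψ hψ hne

/-! ## §1 The E-side at ANY good prime `p ≥ 5` under the printed binders (iii) and (iv) -/

/-- **E-SIDE: `#Sel_p(E/ℚ) ≤ p^{ν(n)}` from ONE unit mod-`p` Kurihara number at a cyclic level `n`, at ANY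
GOOD prime `p ≥ 5` (ordinary or supersingular).** `W` globally minimal elliptic; `p ≥ 5` good with `ρ̄_{E,p}`
onto; `ht0 : E(ℚ_p)[p] = 0` (Kim's (iii) verbatim); `htam : p ∤ ∏_v c_v` (Kim's (iv) verbatim); `n` a cyclic
Kolyvagin level; the CLAIM `hδ` (shape of `KuriharaCertificates.Record.Claim`). The datum with `p ∤ c_D`
exists by modularity + Mazur 1978 Cor. 4.1 + Néron scaling (`p ∤ N_E` since `p` is good), the period
transfer by Mazur's corollary (`SkinnerUrban2014.realPeriodRat_eq_unit_mul_plusPeriod_of_mazur`: good `p`,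
`E[p]` irreducible — no ordinarity), and Kim's Theorem 1.11 at a good prime (`hKimG`) concludes — the proof of
v24's `natCard_selmerGroup_le_pow_of_kuriharaClaim_of_localTorsionTrivial` with `hord` never used.
CONDITIONAL on the three named facts and the claim; BSD is not proved by it.
[cite: Kim2022StructureSelmer, Thm. 1.11 with hypotheses (iii), (iv) (PDF p. 8)] [cite: Mazur1978, Cor. 4.1] -/
theorem natCard_selmerGroup_le_pow_of_kuriharaClaim_of_hasGoodReduction
    (hKimG : Literature.NumberTheory.EllipticCurves.Kim2022_card_selmerGroup_le_pow_of_kuriharaNumber_ne_zero_of_hasGoodReduction)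
    (hnf : exists_isNewformOf) (hMaz : mazur_not_dvd_maninConstant_of_odd)
    (W : WeierstrassCurve ℚ) [W.IsElliptic] [W.IsGloballyMinimal] (p : ℕ) [hp : Fact p.Prime] (h5 : 5 ≤ p)
    (hgood : W.HasGoodReductionAtPrime p) (hsur : W.HasSurjectiveModNGaloisRep p)
    (ht0 : ∀ P : (W.baseChange ℚ_[p]).toAffine.Point, (p : ℤ) • P = 0 → P = 0)
    (htam : ¬ p ∣ W.tamagawaProduct)
    [iNZ : NeZero (W.conductorNorm ℤ)] (n : ℕ) [NeZero n] (hn : IsCyclicKolyvaginLevel W p n)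
    (hδ : ∀ (D : ModularParametrizationData W (W.conductorNorm ℤ)), ¬ (p : ℤ) ∣ D.maninConstant →
      (∃ u : ℚ, ‖(u : ℚ_[p])‖ = 1 ∧ W.realPeriodRat = u * plusPeriod D.f) →
      ∃ ψ : (ℓ : ℕ) → (ZMod ℓ)ˣ →* Multiplicative (ZMod p),
        (∀ ℓ ∈ n.primeFactors, Function.Surjective (ψ ℓ)) ∧ kuriharaNumber D.f p n ψ ≠ 0) :
    Nat.card (W.selmerGroup p) ≤ p ^ n.primeFactors.card := by
  have hpP : p.Prime := hp.out
  have hp2 : p ≠ 2 := by omega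
  haveI : NeZero (p : ℚ) := ⟨by exact_mod_cast hpP.ne_zero⟩
  have hirr : W.HasIrreducibleModPGaloisRep p := hasIrreducibleModPGaloisRep_of_hasSurjectiveModNGaloisRep W p hsur
  -- the datum with `p ∤ c_D` (modularity + Mazur + Néron scaling; `p ∤ N_E` as `p` is good)
  have hpN : ¬ p ^ 2 ∣ W.conductorNorm ℤ := fun h ↦
    not_dvd_conductorNorm_of_hasGoodReductionAtPrime W hgood (dvd_trans (dvd_pow_self p two_ne_zero) h)
  obtain ⟨D, hD⟩ := Summit.BirchSwinnertonDyer.Rank1Residual.X11b.exists_modularParametrizationData_not_dvd hnf hMaz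
    integral_neronScaling_of_isGloballyMinimal_holds W rfl hpP hp2 hpN hirr
  have hc : ¬ (p : ℤ) ∣ D.maninConstant := hD
  -- the period transfer (Mazur's corollary; good `p`, `E[p]` irreducible)
  have hu : ∃ u : ℚ, ‖(u : ℚ_[p])‖ = 1 ∧ W.realPeriodRat = u * plusPeriod D.f :=
    SkinnerUrban2014.realPeriodRat_eq_unit_mul_plusPeriod_of_mazur hMaz W p h5 hgood hirr D.f D.isNewformOf
  obtain ⟨ψ, hψ, hne⟩ := hδ D hc hu
  exact hKimG W p h5 hgood hsur ht0 htam D hc hu n hn ψ hψ hne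

/-- **E-SIDE BIT at ANY good prime: `Ш(E/ℚ)[p] = 0` from ONE unit Kurihara number at a cyclic level of depth
`ν(n) ≤ rank_ℤ E(ℚ)`** — §1 + the descent count (`sha_inf_torsionBy_eq_bot_of_natCard_selmerGroup_le`, AEC
X.4.2). CONDITIONAL on `hKimG`, modularity, Mazur and the claim; BSD is not proved by it.
[cite: Kim2022StructureSelmer, Thm. 1.11 (PDF p. 8)] [cite: SilvermanAEC2009, Thm. X.4.2] -/
theorem sha_inf_torsionBy_eq_bot_of_kuriharaClaim_of_hasGoodReduction
    (hKimG : Literature.NumberTheory.EllipticCurves.Kim2022_card_selmerGroup_le_pow_of_kuriharaNumber_ne_zero_of_hasGoodReduction)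
    (hnf : exists_isNewformOf) (hMaz : mazur_not_dvd_maninConstant_of_odd)
    (W : WeierstrassCurve ℚ) [W.IsElliptic] [W.IsGloballyMinimal] (p : ℕ) [hp : Fact p.Prime] (h5 : 5 ≤ p)
    (hgood : W.HasGoodReductionAtPrime p) (hsur : W.HasSurjectiveModNGaloisRep p)
    (ht0 : ∀ P : (W.baseChange ℚ_[p]).toAffine.Point, (p : ℤ) • P = 0 → P = 0)
    (htam : ¬ p ∣ W.tamagawaProduct)
    [iNZ : NeZero (W.conductorNorm ℤ)] (n : ℕ) [NeZero n] (hn : IsCyclicKolyvaginLevel W p n)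
    (hν : n.primeFactors.card ≤ W.mordellWeilRank)
    (hδ : ∀ (D : ModularParametrizationData W (W.conductorNorm ℤ)), ¬ (p : ℤ) ∣ D.maninConstant →
      (∃ u : ℚ, ‖(u : ℚ_[p])‖ = 1 ∧ W.realPeriodRat = u * plusPeriod D.f) →
      ∃ ψ : (ℓ : ℕ) → (ZMod ℓ)ˣ →* Multiplicative (ZMod p),
        (∀ ℓ ∈ n.primeFactors, Function.Surjective (ψ ℓ)) ∧ kuriharaNumber D.f p n ψ ≠ 0) :
    (W.sha ⊓ AddSubgroup.torsionBy W.galH1 (p : ℤ) : AddSubgroup W.galH1) = ⊥ :=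
  sha_inf_torsionBy_eq_bot_of_natCard_selmerGroup_le W p
    ((natCard_selmerGroup_le_pow_of_kuriharaClaim_of_hasGoodReduction hKimG hnf hMaz W p h5 hgood hsur ht0
      htam n hn hδ).trans (Nat.pow_le_pow_right hp.out.pos hν))

/-! ## §2 The two binders of a supersingular row: (iii) from `p ∣ a_p`, (iv) from the split places -/

/-- **Kim's hypothesis (iii) at a SUPERSINGULAR prime: `E(ℚ_p)[p] = 0` whenever `p ≥ 3` is good with
`p ∣ a_p`** — then `p ∤ a_p − 1`, i.e. `p ∤ #Ẽ(𝔽_p)`, and the point count kills the local `p`-torsion (AEC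
VII.2.1/VII.3.1; tree `localTorsion_eq_zero_of_good_of_not_dvd_frobeniusTrace_sub_one`). For `p ≥ 5` good,
`p ∣ a_p ⟺ a_p = 0 ⟺` supersingular (Hasse). [cite: SilvermanAEC2009, VII.3 Prop. 3.1]
[cite: Kim2022StructureSelmer, §3.1.1 (PDF p. 15)] -/
theorem localTorsionTrivial_of_supersingular (W : WeierstrassCurve ℚ) [W.IsElliptic] [W.IsGloballyMinimal]
    (p : ℕ) [hp : Fact p.Prime] (hp3 : 3 ≤ p) (hgood : W.HasGoodReductionAtPrime p)
    (hss : (p : ℤ) ∣ W.frobeniusTrace p) :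
    ∀ P : (W.baseChange ℚ_[p]).toAffine.Point, (p : ℤ) • P = 0 → P = 0 := by
  have hna : ¬ (p : ℤ) ∣ W.frobeniusTrace p - 1 := by
    intro h
    have h1 : (p : ℤ) ∣ 1 := by
      have := dvd_sub hss h
      simpa using this
    have hp1 : (p : ℤ) ≤ 1 := Int.le_of_dvd one_pos h1
    have : (2 : ℤ) ≤ p := by exact_mod_cast hp.out.two_le
    omega
  exact localTorsionTrivial_of_nonAnomalous W p hp3 hgood hna

/-- **Kim's hypothesis (iv) in its EXACT form from the SPLIT places: `p ∤ ∏_v c_v` iff `p ∤ ord_v(Δ_min)` at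
every split multiplicative place `v`** (`p ≥ 5`; Kodaira–Néron: `c_v = ord_v(Δ_min)` at a split
multiplicative place, `c_v ≤ 4` otherwise — the tree's `CornerLocal.not_dvd_tamagawaProduct_iff_forall`). The
crux's Kodaira–Néron clause (ALL multiplicative places, `not_dvd_tamagawaProduct_of_kodairaNeron`) is the
special case; the 494 depth-two unit records of rank-two curves whose prime divides `ord_q(Δ_min)` only at
NON-split multiplicative `q` satisfy (iv) through this lemma. [cite: SilvermanATAEC1994, Cor. IV.9.2 (d) with Table 4.1] -/
theorem not_dvd_tamagawaProduct_of_splitKodairaNeron (W : WeierstrassCurve ℚ) [W.IsElliptic]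
    (p : ℕ) [Fact p.Prime] (h5 : 5 ≤ p)
    (hsKN : ∀ v : HeightOneSpectrum (𝓞 ℚ), W.HasSplitMultiplicativeReductionAt v →
      ¬ p ∣ W.ordMinimalDiscriminant v) :
    ¬ p ∣ W.tamagawaProduct :=
  (CornerLocal.not_dvd_tamagawaProduct_iff_forall W p h5).mpr hsKN

/-! ## §3 Row shapes for a literal integral model (what the per-record rows instantiate) -/

/-- **THE SUPERSINGULAR ROW MECHANISM: `Ш(E/ℚ)[p] = 0` ⟸ ONE unit Kurihara number at a cyclic level with
`ν(n) ≤ rank`, for the rational curve of an integral GLOBALLY MINIMAL equation `E₀`, at a good SUPERSINGULAR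
`p ≥ 5` (`p ∣ a_p`) with `ρ̄` onto and the Kodaira–Néron clause** — (iii) by §2, (iv) by Kodaira–Néron, then
§1. ONE WAY. CONDITIONAL on `hKimG`, modularity, Mazur and the claim; per curve; BSD is not proved by it.
[cite: Kim2022StructureSelmer, Thm. 1.11 (PDF p. 8), §3.1.1] [cite: SilvermanAEC2009, VII.3 Prop. 3.1, Thm. X.4.2] -/
theorem sha_inf_torsionBy_eq_bot_of_kuriharaClaim_of_supersingular
    (hKimG : Literature.NumberTheory.EllipticCurves.Kim2022_card_selmerGroup_le_pow_of_kuriharaNumber_ne_zero_of_hasGoodReduction)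
    (hnf : exists_isNewformOf) (hMaz : mazur_not_dvd_maninConstant_of_odd)
    (W₀ : WeierstrassCurve ℤ) [(W₀.map (Int.castRingHom ℚ)).IsElliptic]
    [(W₀.map (Int.castRingHom ℚ)).IsGloballyMinimal] (p : ℕ) [hp : Fact p.Prime] (h5 : 5 ≤ p)
    (hgood : (W₀.map (Int.castRingHom ℚ)).HasGoodReductionAtPrime p)
    (hss : (p : ℤ) ∣ (W₀.map (Int.castRingHom ℚ)).frobeniusTrace p)
    (hsur : (W₀.map (Int.castRingHom ℚ)).HasSurjectiveModNGaloisRep p)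
    (hKN : ∀ v : HeightOneSpectrum (𝓞 ℚ), (W₀.map (Int.castRingHom ℚ)).HasMultiplicativeReductionAt v →
      ¬ p ∣ (W₀.map (Int.castRingHom ℚ)).ordMinimalDiscriminant v)
    [iNZ : NeZero ((W₀.map (Int.castRingHom ℚ)).conductorNorm ℤ)] (n : ℕ) [NeZero n]
    (hn : IsCyclicKolyvaginLevel (W₀.map (Int.castRingHom ℚ)) p n)
    (hν : n.primeFactors.card ≤ (W₀.map (Int.castRingHom ℚ)).mordellWeilRank)
    (hδ : ∀ (D : ModularParametrizationData (W₀.map (Int.castRingHom ℚ))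
        ((W₀.map (Int.castRingHom ℚ)).conductorNorm ℤ)), ¬ (p : ℤ) ∣ D.maninConstant →
      (∃ u : ℚ, ‖(u : ℚ_[p])‖ = 1 ∧ (W₀.map (Int.castRingHom ℚ)).realPeriodRat = u * plusPeriod D.f) →
      ∃ ψ : (ℓ : ℕ) → (ZMod ℓ)ˣ →* Multiplicative (ZMod p),
        (∀ ℓ ∈ n.primeFactors, Function.Surjective (ψ ℓ)) ∧ kuriharaNumber D.f p n ψ ≠ 0) :
    ((W₀.map (Int.castRingHom ℚ)).sha ⊓
        AddSubgroup.torsionBy (W₀.map (Int.castRingHom ℚ)).galH1 (p : ℤ) : AddSubgroup _) = ⊥ :=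
  sha_inf_torsionBy_eq_bot_of_kuriharaClaim_of_hasGoodReduction hKimG hnf hMaz _ p h5 hgood hsur
    (localTorsionTrivial_of_supersingular _ p (by omega) hgood hss)
    (not_dvd_tamagawaProduct_of_kodairaNeron _ p h5 hKN) n hn hν hδ

/-- **The general good-prime row shape** (ordinary or supersingular, anomalous allowed): `Ш(E/ℚ)[p] = 0` ⟸ ONE
unit Kurihara number at a cyclic level with `ν(n) ≤ rank`, for the rational curve of an integral globally
minimal `E₀`, at a good `p ≥ 5` with `ρ̄` onto, the binder (iii) `E(ℚ_p)[p] = 0` (point count or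
division-polynomial certificate) and (iv) from the SPLIT multiplicative places only. ONE WAY. CONDITIONAL on
`hKimG`, modularity, Mazur and the claim; per curve; BSD is not proved by it.
[cite: Kim2022StructureSelmer, Thm. 1.11 (PDF p. 8)] [cite: SilvermanATAEC1994, Cor. IV.9.2 (d)] -/
theorem sha_inf_torsionBy_eq_bot_of_kuriharaClaim_of_hasGoodReduction_int
    (hKimG : Literature.NumberTheory.EllipticCurves.Kim2022_card_selmerGroup_le_pow_of_kuriharaNumber_ne_zero_of_hasGoodReduction)
    (hnf : exists_isNewformOf) (hMaz : mazur_not_dvd_maninConstant_of_odd)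
    (W₀ : WeierstrassCurve ℤ) [(W₀.map (Int.castRingHom ℚ)).IsElliptic]
    [(W₀.map (Int.castRingHom ℚ)).IsGloballyMinimal] (p : ℕ) [hp : Fact p.Prime] (h5 : 5 ≤ p)
    (hgood : (W₀.map (Int.castRingHom ℚ)).HasGoodReductionAtPrime p)
    (hsur : (W₀.map (Int.castRingHom ℚ)).HasSurjectiveModNGaloisRep p)
    (ht0 : ∀ P : ((W₀.map (Int.castRingHom ℚ)).baseChange ℚ_[p]).toAffine.Point, (p : ℤ) • P = 0 → P = 0)
    (hsKN : ∀ v : HeightOneSpectrum (𝓞 ℚ), (W₀.map (Int.castRingHom ℚ)).HasSplitMultiplicativeReductionAt v →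
      ¬ p ∣ (W₀.map (Int.castRingHom ℚ)).ordMinimalDiscriminant v)
    [iNZ : NeZero ((W₀.map (Int.castRingHom ℚ)).conductorNorm ℤ)] (n : ℕ) [NeZero n]
    (hn : IsCyclicKolyvaginLevel (W₀.map (Int.castRingHom ℚ)) p n)
    (hν : n.primeFactors.card ≤ (W₀.map (Int.castRingHom ℚ)).mordellWeilRank)
    (hδ : ∀ (D : ModularParametrizationData (W₀.map (Int.castRingHom ℚ))
        ((W₀.map (Int.castRingHom ℚ)).conductorNorm ℤ)), ¬ (p : ℤ) ∣ D.maninConstant →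
      (∃ u : ℚ, ‖(u : ℚ_[p])‖ = 1 ∧ (W₀.map (Int.castRingHom ℚ)).realPeriodRat = u * plusPeriod D.f) →
      ∃ ψ : (ℓ : ℕ) → (ZMod ℓ)ˣ →* Multiplicative (ZMod p),
        (∀ ℓ ∈ n.primeFactors, Function.Surjective (ψ ℓ)) ∧ kuriharaNumber D.f p n ψ ≠ 0) :
    ((W₀.map (Int.castRingHom ℚ)).sha ⊓
        AddSubgroup.torsionBy (W₀.map (Int.castRingHom ℚ)).galH1 (p : ℤ) : AddSubgroup _) = ⊥ :=
  sha_inf_torsionBy_eq_bot_of_kuriharaClaim_of_hasGoodReduction hKimG hnf hMaz _ p h5 hgood hsur ht0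
    (not_dvd_tamagawaProduct_of_splitKodairaNeron _ p h5 hsKN) n hn hν hδ

end Summit.BirchSwinnertonDyer.BirchSwinnertonDyer.Theorems.KolyvaginDepthDoor

end
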